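import Literature.MathematicalPhysics.QuantumFieldTheory.Luscher2010.FlowExistenceProofs
import Summits.Ventures.LatticeQCDFlow.Scaling.SpecialUnitarySmallBall

/-!
# LatticeQCDFlow / Scaling — the Lipschitz budget of an exact trivializing FLOW (Grönwall × the calibrated window law)

HONEST FRAMING: exact (Metropolis-corrected) sampling algorithms for lattice gauge theory; figures of merit are
autocorrelation/cost numbers at stated couplings and volumes; no continuum-physics claim.

Venture `LatticeQCDFlow` (cell pub-lqcd), topic `Scaling`, FANOUT row 30 (lean-1) — OUR WORK: the "continuous-flow
(Grönwall) corollary" of the transport window laws, listed as NOT typed in THEORY-2.md §0⁺ (v2.9) "for want of an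
ODE-on-Lie-group API".  The API exists: Lüscher's flow interface (`Luscher2010.Generator`, `IsFlowLine`, `IsFlowMap`
— `Literature/…/Luscher2010/TrivializingMaps.lean`; its global existence `flowGlobalExistence_holds` and the ambient
field `FlowExistence.vf₀ Z t W = (Z_t(W)(e)·W(e))_e` with `FlowExistence.hasDerivAt_of_isFlowLine` —
`Luscher2010/FlowExistenceProofs.lean`) reads every flow line as a solution of an ODE in the ambient normed space
`M_n(ℂ)^E` (sup of Hilbert–Schmidt norms), where Mathlib's Grönwall inequality
(`dist_le_of_trajectories_ODE_of_mem`) applies.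

* `dist_coeConfig` — `SU(n)^E ↪ M_n(ℂ)^E` is an isometry of the sup metrics;
* `lipschitzWith_flowMap_one` — **Grönwall for flow maps**: if the ambient field of the generator is `K`-Lipschitz
  on the field manifold for `t ∈ [0, 1)`, then `𝓕₁ = Φ 1` is `e^K`-Lipschitz; `lipschitzOnWith_vf₀` — a generator
  `Z_t` that is `K`-Lipschitz and linkwise bounded by `M` on the field manifold has a `(K + M)`-Lipschitz ambient field;
* `flow_lipschitz_budget` — **the budget**: for `SU(n)`, `n ≥ 1`, every `L`, `0 ≤ β₀ ≤ β`: if such a flow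
  TRANSPORTS `μ_{Λ,β₀}` onto `μ_{Λ,β}` (`(Φ 1)_* μ_{β₀} = μ_β`), then for EVERY configuration `U`
  `(β - β₀)·(S(U) - ⟨S⟩_{Λ,β₀}) ≤ (n² - 1)·#E·K` (`SUN.calibratedCoolingWindow_zero` + `log e^K = K`);
  `flow_lipschitz_budget_su3`: `SU(3)`: `8·#E·K ≥ (β - β₀)·(S(U) - ⟨S⟩_{β₀})`.  At `β₀ = 0` (Haar start,
  `⟨S⟩₀ = N·#P` for `N ≥ 2`) this reads `K ≥ β·(S(U) - N·#P)/((N²-1)·#E)` for every `U`; `SU(3)`, `d = 4`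
  (`#P = 6L⁴`, `#E = 4L⁴`, per-plaquette action `3 - Re tr U_p ≤ 9/2`, with equality at the centre elements
  `e^{±2πi/3}·1`; for `3 ∣ L` the uniform centre-flux configuration has ALL plaquettes there, `S = 27L⁴`):
  `K ≥ 9β/32` — the generating field of ANY exact trivializing flow of `SU(3)` at `β` from the Haar prior has
  Lipschitz modulus at least `0.28·β` on the field manifold, uniformly in the volume (markdown arithmetic on the
  theorem's right side; the configuration is not constructed in this file).

Elementary given the tree; nothing is cited as a fact.  Reading: Lüscher, CMP 293 (2010) §3 (the flow equation);
Grönwall's lemma (Mathlib `Mathlib/Analysis/ODE/Gronwall.lean`).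
-/

noncomputable section

open scoped Matrix.Norms.Frobenius NNReal
open MeasureTheory Metric Set Filter Topology
open Literature.MathematicalPhysics.QuantumFieldTheory
open Literature.MathematicalPhysics.QuantumFieldTheory.Luscher2010
open Literature.MathematicalPhysics.QuantumLattice (fundamentalRep)

namespace Summit.Ventures.LatticeQCDFlow.Theory2.Lattice.SUN

section Gronwall

variable {d L n : ℕ} [NeZero L]

/-- **`SU(n)^E ↪ M_n(ℂ)^E` is an isometry** of the sup metrics (per link the Hilbert–Schmidt distance of the subtype).
[folklore] -/
theorem dist_coeConfig (U V : GaugeConfig d L (Matrix.specialUnitaryGroup (Fin n) ℂ)) :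
    dist (WilsonFlow.coeConfig U) (WilsonFlow.coeConfig V) = dist U V := by
  simp only [dist_pi_def, WilsonFlow.coeConfig_apply, Subtype.nndist_eq]

/-- **Grönwall for flow maps.**  Let `Φ` be a flow map of the generator `Z` (`IsFlowMap Z Φ`: `Φ 0 = id`, every
`t ↦ Φ t V` a flow line of `U̇ = Z_t(U) U`) whose ambient field `W ↦ (Z_t(W)(e)·W(e))_e` is `K`-Lipschitz on the
field manifold `SU(n)^E ⊆ M_n(ℂ)^E` for `t ∈ [0, 1)`.  Then `Φ 1` is `e^K`-Lipschitz (sup of Hilbert–Schmidt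
distances). [folklore] -/
theorem lipschitzWith_flowMap_one {Z : Generator d L n}
    {Φ : ℝ → GaugeConfig d L (Matrix.specialUnitaryGroup (Fin n) ℂ) →
      GaugeConfig d L (Matrix.specialUnitaryGroup (Fin n) ℂ)}
    (hΦ : IsFlowMap Z Φ) {K : ℝ≥0}
    (hK : ∀ t ∈ Ico (0 : ℝ) 1, LipschitzOnWith K (FlowExistence.vf₀ Z t) (Set.range WilsonFlow.coeConfig)) :
    LipschitzWith (Real.toNNReal (Real.exp K)) (Φ 1) := by
  refine LipschitzWith.of_dist_le_mul fun V W => ?_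
  set f : ℝ → AmbConfig d L n := fun t => WilsonFlow.coeConfig (Φ t V) with hf
  set g : ℝ → AmbConfig d L n := fun t => WilsonFlow.coeConfig (Φ t W) with hg
  have hfd : ∀ t, HasDerivAt f (FlowExistence.vf₀ Z t (f t)) t :=
    FlowExistence.hasDerivAt_of_isFlowLine (hΦ.2 V)
  have hgd : ∀ t, HasDerivAt g (FlowExistence.vf₀ Z t (g t)) t :=
    FlowExistence.hasDerivAt_of_isFlowLine (hΦ.2 W)
  have h := dist_le_of_trajectories_ODE_of_mem (v := FlowExistence.vf₀ Z)
    (s := fun _ => Set.range WilsonFlow.coeConfig) (K := K) (f := f) (g := g) (a := 0) (b := 1)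
    (δ := dist (f 0) (g 0)) hK
    (fun t _ => (hfd t).continuousAt.continuousWithinAt) (fun t _ => (hfd t).hasDerivWithinAt)
    (fun t _ => ⟨Φ t V, rfl⟩)
    (fun t _ => (hgd t).continuousAt.continuousWithinAt) (fun t _ => (hgd t).hasDerivWithinAt)
    (fun t _ => ⟨Φ t W, rfl⟩) le_rfl 1 (right_mem_Icc.2 zero_le_one)
  rw [hf, hg] at h
  simp only [dist_coeConfig, hΦ.1, sub_zero, mul_one] at h
  rw [Real.coe_toNNReal _ (Real.exp_pos _).le, mul_comm]
  exact h

/-- **From the generator to its ambient field.**  If on the field manifold `Z_t` is `K`-Lipschitz (sup of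
Hilbert–Schmidt norms) and bounded by `M` linkwise, then the ambient field `W ↦ (Z_t(W)(e)·W(e))_e` is
`(K + M)`-Lipschitz there (`‖A·U‖ = ‖A‖` for unitary `U`, `‖A·B‖ ≤ ‖A‖·‖B‖`). [folklore] -/
theorem lipschitzOnWith_vf₀ {Z : Generator d L n} {t : ℝ} {K M : ℝ≥0}
    (hZ : LipschitzOnWith K (Z t) (Set.range WilsonFlow.coeConfig))
    (hM : ∀ (U : GaugeConfig d L (Matrix.specialUnitaryGroup (Fin n) ℂ)) (e : Edge d L),
      ‖Z t (WilsonFlow.coeConfig U) e‖ ≤ M) :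
    LipschitzOnWith (K + M) (FlowExistence.vf₀ Z t) (Set.range WilsonFlow.coeConfig) := by
  refine LipschitzOnWith.of_dist_le_mul fun W hW W' hW' => ?_
  obtain ⟨U, rfl⟩ := hW
  obtain ⟨U', rfl⟩ := hW'
  have hZd := hZ.dist_le_mul _ ⟨U, rfl⟩ _ ⟨U', rfl⟩
  rw [NNReal.coe_add]
  refine (dist_pi_le_iff (by positivity)).2 fun e => ?_
  have hUe : ((U e : Matrix.specialUnitaryGroup (Fin n) ℂ) : Matrix (Fin n) (Fin n) ℂ) ∈
      Matrix.unitaryGroup (Fin n) ℂ := (Matrix.mem_specialUnitaryGroup_iff.1 (U e).2).1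
  have h1 : ‖(Z t (WilsonFlow.coeConfig U) e - Z t (WilsonFlow.coeConfig U') e) * WilsonFlow.coeConfig U e‖ =
      ‖Z t (WilsonFlow.coeConfig U) e - Z t (WilsonFlow.coeConfig U') e‖ := by
    rw [WilsonFlow.coeConfig_apply]
    exact Matrix.frobenius_norm_mul_unitaryGroup _ ⟨_, hUe⟩
  have h2 : ‖Z t (WilsonFlow.coeConfig U) e - Z t (WilsonFlow.coeConfig U') e‖ ≤
      K * dist (WilsonFlow.coeConfig U) (WilsonFlow.coeConfig U') := by
    rw [← dist_eq_norm]
    exact (dist_le_pi_dist _ _ e).trans hZd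
  have h3 : ‖WilsonFlow.coeConfig U e - WilsonFlow.coeConfig U' e‖ ≤
      dist (WilsonFlow.coeConfig U) (WilsonFlow.coeConfig U') := by
    rw [← dist_eq_norm]; exact dist_le_pi_dist _ _ e
  have hM' := hM U' e
  calc dist (FlowExistence.vf₀ Z t (WilsonFlow.coeConfig U) e) (FlowExistence.vf₀ Z t (WilsonFlow.coeConfig U') e)
      = ‖(Z t (WilsonFlow.coeConfig U) e - Z t (WilsonFlow.coeConfig U') e) * WilsonFlow.coeConfig U e +
          Z t (WilsonFlow.coeConfig U') e * (WilsonFlow.coeConfig U e - WilsonFlow.coeConfig U' e)‖ := by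
        rw [dist_eq_norm]; congr 1
        simp only [FlowExistence.vf₀, Matrix.sub_mul, Matrix.mul_sub]; abel
    _ ≤ ‖Z t (WilsonFlow.coeConfig U) e - Z t (WilsonFlow.coeConfig U') e‖ +
          ‖Z t (WilsonFlow.coeConfig U') e‖ * ‖WilsonFlow.coeConfig U e - WilsonFlow.coeConfig U' e‖ := by
        refine (norm_add_le _ _).trans (add_le_add (le_of_eq h1) (norm_mul_le _ _))
    _ ≤ K * dist (WilsonFlow.coeConfig U) (WilsonFlow.coeConfig U') +
          M * dist (WilsonFlow.coeConfig U) (WilsonFlow.coeConfig U') :=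
        add_le_add h2 (mul_le_mul hM' h3 (norm_nonneg _) (by positivity))
    _ = (K + M) * dist (WilsonFlow.coeConfig U) (WilsonFlow.coeConfig U') := by ring

end Gronwall

section Budget

variable {L : ℕ} [NeZero L]

/-- **The Lipschitz budget of an exact trivializing flow** (OURS; THEORY-2's continuous-flow corollary of the
calibrated window law, `SU(n)`, `n ≥ 1`): if a flow map `Φ` of a generator whose ambient field is `K`-Lipschitz on
the field manifold for `t ∈ [0,1)` transports `μ_{Λ,β₀}` onto `μ_{Λ,β}` (`0 ≤ β₀ ≤ β`), then for every configuration
`U`, `(β - β₀)·(S(U) - ⟨S⟩_{Λ,β₀}) ≤ #E·((n² - 1)·K)`. [folklore] -/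
theorem flow_lipschitz_budget (d n : ℕ) (hn : 1 ≤ n) {Z : Generator d L n}
    {Φ : ℝ → GaugeConfig d L (Matrix.specialUnitaryGroup (Fin n) ℂ) →
      GaugeConfig d L (Matrix.specialUnitaryGroup (Fin n) ℂ)}
    (hΦ : IsFlowMap Z Φ) {K : ℝ≥0}
    (hK : ∀ t ∈ Ico (0 : ℝ) 1, LipschitzOnWith K (FlowExistence.vf₀ Z t) (Set.range WilsonFlow.coeConfig))
    {β₀ β : ℝ} (hβ₀ : 0 ≤ β₀) (hβ : β₀ ≤ β)
    (hmap : (wilsonMeasure (d := d) (L := L) (fundamentalRep (Fin n)) β₀).map (Φ 1) =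
      wilsonMeasure (d := d) (L := L) (fundamentalRep (Fin n)) β)
    (U : GaugeConfig d L (Matrix.specialUnitaryGroup (Fin n) ℂ)) :
    (β - β₀) * (wilsonAction (fundamentalRep (Fin n)) U -
        wilsonExpectation (d := d) (L := L) (fundamentalRep (Fin n)) β₀
          (wilsonAction (d := d) (L := L) (fundamentalRep (Fin n)))) ≤
      Fintype.card (Edge d L) * (((n * n - 1 : ℕ) : ℝ) * K) := by
  have hW := calibratedCoolingWindow_zero d n hn
  have hpos : 0 < ((Real.toNNReal (Real.exp K) : ℝ≥0) : ℝ) := by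
    rw [Real.coe_toNNReal _ (Real.exp_pos _).le]; exact Real.exp_pos _
  have h := hW L β₀ β hβ₀ hβ (Φ 1) (Real.toNNReal (Real.exp K)) hpos (lipschitzWith_flowMap_one hΦ hK) hmap U
  rw [Real.coe_toNNReal _ (Real.exp_pos _).le, Real.log_exp, zero_add] at h
  exact h

/-- **`SU(3)` reading**: `8·#E·K ≥ (β - β₀)·(S(U) - ⟨S⟩_{Λ,β₀})` for every exact trivializing flow of `SU(3)` Wilson
laws whose generating field is `K`-Lipschitz on the field manifold (every `d`; `d = 4`: `#E = 4L⁴`). [folklore] -/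
theorem flow_lipschitz_budget_su3 (d : ℕ) {Z : Generator d L 3}
    {Φ : ℝ → GaugeConfig d L (Matrix.specialUnitaryGroup (Fin 3) ℂ) →
      GaugeConfig d L (Matrix.specialUnitaryGroup (Fin 3) ℂ)}
    (hΦ : IsFlowMap Z Φ) {K : ℝ≥0}
    (hK : ∀ t ∈ Ico (0 : ℝ) 1, LipschitzOnWith K (FlowExistence.vf₀ Z t) (Set.range WilsonFlow.coeConfig))
    {β₀ β : ℝ} (hβ₀ : 0 ≤ β₀) (hβ : β₀ ≤ β)
    (hmap : (wilsonMeasure (d := d) (L := L) (fundamentalRep (Fin 3)) β₀).map (Φ 1) =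
      wilsonMeasure (d := d) (L := L) (fundamentalRep (Fin 3)) β)
    (U : GaugeConfig d L (Matrix.specialUnitaryGroup (Fin 3) ℂ)) :
    (β - β₀) * (wilsonAction (fundamentalRep (Fin 3)) U -
        wilsonExpectation (d := d) (L := L) (fundamentalRep (Fin 3)) β₀
          (wilsonAction (d := d) (L := L) (fundamentalRep (Fin 3)))) ≤
      Fintype.card (Edge d L) * (8 * K) := by
  have h := flow_lipschitz_budget d 3 (by norm_num) hΦ hK hβ₀ hβ hmap U
  have h8 : ((3 * 3 - 1 : ℕ) : ℝ) = 8 := by norm_num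
  rw [h8] at h
  exact h

end Budget

end Summit.Ventures.LatticeQCDFlow.Theory2.Lattice.SUN

end
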